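import Summits.QuantumFields.QCD.Theses.HeatSlicedQuarks
import Summits.QuantumFields.QCD.Theorems.HeatSlicedQuarksInterleavedHeatSliceFlowStubFreeColumnProfile
import Summits.QuantumFields.QCD.Theorems.HeatSlicedQuarksSmallFieldUltracontractivityStubFreeRowBounds
import Summits.QuantumFields.QCD.Theorems.HeatSlicedQuarksInterleavedHeatSliceFlowStubColumnIdentificationAux
import Literature.MathematicalPhysics.QuantumLattice.LatticeToriProofs

/-!
# Stub `stub_freeTimeDerivativeProfile` of line `Sketch`
(crux `Summit.QuantumFields.QCD.Theses.HeatSlicedQuarks.TracedQuadraticParametrix`, item stmt-QuantumFields-17985)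

**FreeTimeDerivativeProfile.**  Let `D₁ = wilsonDirac ρ 1 m 1` be the FREE massive `r = 1` Wilson–Dirac
matrix on the discrete four-torus `T_L = (ℤ/L)⁴` (all links `= 1`), `H₁ = D₁ᴴ D₁` and `K₁(σ) = e^{-σH₁}`.
For `m ∈ [-1/2, 1]`, `0 ≤ σ ≤ L²` and `d = torusDist x z`, the time derivative of the free heat kernel
has the free profile with one more inverse power of `1 + σ`:

  `|(H₁ K₁(σ))((z,b,β),(x,a,α))| ≤ C e^{-cσm²} / (1 + σ + d²)³`.

Proof (no Fourier analysis).
1. `H₁ K₁(σ) = (D₁K₁(σ/2))ᴴ (D₁K₁(σ/2))`: `K₁(σ) = K₁(σ/2)²` (`Matrix.exp_add_of_commute`), `H₁` commutes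
   with `K₁(σ/2)` (`exp_mul_eq_mul_exp_of_comm`) and `K₁(σ/2)` is Hermitian (`isHermitian_exp_neg_smul`).
   Hence `|(H₁K₁(σ))(q,p)| ≤ Σ_{q'} |M(q',q)| |M(q',p)|` with `M = D₁K₁(σ/2)`.
2. Both factors carry the landed `D₁`-profile of `stub_freeColumnProfile` (2) at time `σ/2`:
   `|M((y,c,γ),(z,b,β))| ≤ C e^{-c(σ/2)m²} √s/(s + d(z,y)²)³`, `s = 1 + σ/2`; the `12` colour–spin values
   of `q'` give a factor `12`.
3. Convolution: by the triangle inequality one of `d(z,y)`, `d(x,y)` is `≥ d(x,z)/2`, and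
   `4(s + (d/2)²) ≥ 1 + σ + d²`, so pointwise
   `(s+d(z,y)²)⁻³ (s+d(x,y)²)⁻³ ≤ 64 (1+σ+d²)⁻³ ((s+d(z,y)²)⁻³ + (s+d(x,y)²)⁻³)`,
   and each of the two remaining sums over ALL `y` is `≤ 192/s` by the landed radial moment
   `sum_inv_cube_le` (module `…StubFreeRowBounds`).
4. Bookkeeping: `12 · C² e^{-cσm²} · s · 64 · 384/(s (1+σ+d²)³)`; the factor `s = (√s)²` of the two
   `D₁`-profiles cancels against the `1/s` of the moment.  Constants: `C' = 294912 C²`, `c' = c`.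
No named facts are used beyond the landed stubs. [folklore]
-/

noncomputable section

namespace Summit.QuantumFields.QCD.Cruxes.TracedQuadraticParametrix.Sketch

open Literature.MathematicalPhysics.QuantumLattice Literature.MathematicalPhysics.QuantumFieldTheory
  Literature.Probability.LatticeModels
open Summit.QuantumFields.QCD.Theses.HeatSlicedQuarks
open Summit.QuantumFields.QCD.Cruxes.InterleavedHeatSliceFlow.Sketch
open Summit.QuantumFields.QCD.Theorems.SmallFieldUltracontractivity.Negative
open Summit.QuantumFields.QCD.Cruxes.SmallFieldUltracontractivity.PointCentredAxialParabolic
  (sum_inv_cube_le sum_siteColourSpin)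
open scoped Matrix

/-! ### Matrix identities -/

-- adapted from HeatSlicedQuarksInterleavedHeatSliceFlowStubInteriorAssembly.lean
/-- The heat kernel at time `t` is the square of the heat kernel at time `t/2`. -/
private theorem exp_neg_smul_eq_sq' {ι : Type} [Fintype ι] [DecidableEq ι] (H : Matrix ι ι ℂ)
    (t : ℝ) :
    NormedSpace.exp (-(t : ℂ) • H) =
      NormedSpace.exp (-((t / 2 : ℝ) : ℂ) • H) * NormedSpace.exp (-((t / 2 : ℝ) : ℂ) • H) := by
  set X : Matrix ι ι ℂ := -((t / 2 : ℝ) : ℂ) • H with hX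
  have hsum : -(t : ℂ) • H = X + X := by
    rw [hX, ← add_smul]; congr 1; push_cast; ring
  rw [hsum, Matrix.exp_add_of_commute X X (Commute.refl X)]

/-- The T*T form of the time derivative of the heat kernel:
`AᴴA · e^{-tAᴴA} = (A e^{-(t/2)AᴴA})ᴴ (A e^{-(t/2)AᴴA})`. -/
private theorem conjTranspose_mul_self_mul_exp_eq {ι : Type} [Fintype ι] [DecidableEq ι]
    (A : Matrix ι ι ℂ) (t : ℝ) :
    Aᴴ * A * NormedSpace.exp (-(t : ℂ) • (Aᴴ * A)) =
      (A * NormedSpace.exp (-((t / 2 : ℝ) : ℂ) • (Aᴴ * A)))ᴴ *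
        (A * NormedSpace.exp (-((t / 2 : ℝ) : ℂ) • (Aᴴ * A))) := by
  set K : Matrix ι ι ℂ := NormedSpace.exp (-((t / 2 : ℝ) : ℂ) • (Aᴴ * A)) with hK
  have hKh : Kᴴ = K := (isHermitian_exp_neg_smul A (t / 2)).eq
  have hcomm : Aᴴ * A * K = K * (Aᴴ * A) :=
    (exp_mul_eq_mul_exp_of_comm _ _ (Aᴴ * A) (by rw [Matrix.smul_mul, Matrix.mul_smul])).symm
  rw [exp_neg_smul_eq_sq' (Aᴴ * A) t, Matrix.conjTranspose_mul, hKh]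
  calc Aᴴ * A * (K * K) = Aᴴ * A * K * K := (Matrix.mul_assoc _ _ _).symm
    _ = K * (Aᴴ * A) * K := by rw [hcomm]
    _ = K * Aᴴ * (A * K) := by simp only [Matrix.mul_assoc]

/-- Entry bound for a T*T product: `|(MᴴM)(q,p)| ≤ Σ_{q'} |M(q',q)| |M(q',p)|`. -/
private theorem norm_conjTranspose_mul_self_apply_le {ι : Type} [Fintype ι] (M : Matrix ι ι ℂ)
    (q p : ι) : ‖(Mᴴ * M) q p‖ ≤ ∑ q', ‖M q' q‖ * ‖M q' p‖ := by
  rw [Matrix.mul_apply]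
  refine (norm_sum_le _ _).trans (le_of_eq (Finset.sum_congr rfl fun q' _ => ?_))
  rw [Matrix.conjTranspose_apply, norm_mul, norm_star]

/-! ### The lattice convolution -/

/-- Pointwise convolution inequality: if `n ≤ k + l` (triangle inequality) then
`(s+l²)⁻³ (s+k²)⁻³ ≤ 64 (1+σ+n²)⁻³ ((s+l²)⁻³ + (s+k²)⁻³)` with `s = 1 + σ/2`, because one of
`k, l` is `≥ n/2` and `4(s + (n/2)²) ≥ 1 + σ + n²`. -/
private theorem conv_pointwise {σ : ℝ} (hσ : 0 ≤ σ) {n k l : ℕ} (htri : n ≤ k + l) :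
    1 / (1 + σ / 2 + (l : ℝ) ^ 2) ^ 3 * (1 / (1 + σ / 2 + (k : ℝ) ^ 2) ^ 3) ≤
      64 / (1 + σ + (n : ℝ) ^ 2) ^ 3 *
        (1 / (1 + σ / 2 + (l : ℝ) ^ 2) ^ 3 + 1 / (1 + σ / 2 + (k : ℝ) ^ 2) ^ 3) := by
  have hB : 0 < 1 + σ + (n : ℝ) ^ 2 := by positivity
  have hgen : ∀ j : ℕ, n ≤ 2 * j →
      1 / (1 + σ / 2 + (j : ℝ) ^ 2) ^ 3 ≤ 64 / (1 + σ + (n : ℝ) ^ 2) ^ 3 := by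
    intro j hj
    have hj' : (n : ℝ) ≤ 2 * j := by exact_mod_cast hj
    have hA : 0 < 1 + σ / 2 + (j : ℝ) ^ 2 := by positivity
    have hle : 1 + σ + (n : ℝ) ^ 2 ≤ 4 * (1 + σ / 2 + (j : ℝ) ^ 2) := by
      nlinarith [mul_le_mul hj' hj' (Nat.cast_nonneg n) (by positivity)]
    rw [div_le_div_iff₀ (pow_pos hA 3) (pow_pos hB 3), one_mul]
    calc (1 + σ + (n : ℝ) ^ 2) ^ 3 ≤ (4 * (1 + σ / 2 + (j : ℝ) ^ 2)) ^ 3 :=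
          pow_le_pow_left₀ hB.le hle 3
      _ = 64 * (1 + σ / 2 + (j : ℝ) ^ 2) ^ 3 := by ring
  have hf0 : 0 ≤ 1 / (1 + σ / 2 + (l : ℝ) ^ 2) ^ 3 := by positivity
  have hg0 : 0 ≤ 1 / (1 + σ / 2 + (k : ℝ) ^ 2) ^ 3 := by positivity
  have hM0 : 0 ≤ 64 / (1 + σ + (n : ℝ) ^ 2) ^ 3 := by positivity
  set f := 1 / (1 + σ / 2 + (l : ℝ) ^ 2) ^ 3
  set g := 1 / (1 + σ / 2 + (k : ℝ) ^ 2) ^ 3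
  set B := 64 / (1 + σ + (n : ℝ) ^ 2) ^ 3
  rcases le_or_gt n (2 * l) with h | h
  · calc f * g ≤ B * g := mul_le_mul_of_nonneg_right (hgen l h) hg0
      _ ≤ B * (f + g) := mul_le_mul_of_nonneg_left (le_add_of_nonneg_left hf0) hM0
  · have h2 : n ≤ 2 * k := by omega
    calc f * g ≤ f * B := mul_le_mul_of_nonneg_left (hgen k h2) hf0
      _ = B * f := mul_comm _ _
      _ ≤ B * (f + g) := mul_le_mul_of_nonneg_left (le_add_of_nonneg_right hg0) hM0

/-- The lattice convolution of two free profiles at time `σ/2` (`s = 1 + σ/2`):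
`Σ_y (s+d(z,y)²)⁻³ (s+d(x,y)²)⁻³ ≤ 24576/(s (1+σ+d(x,z)²)³)`, uniformly in `L`. [folklore] -/
theorem freeTimeDerivativeProfile_convolution {L : ℕ} [NeZero L] (x z : TorusSite 4 L) {σ : ℝ}
    (hσ : 0 ≤ σ) :
    ∑ y : TorusSite 4 L, 1 / (1 + σ / 2 + (torusDist z y : ℝ) ^ 2) ^ 3 *
        (1 / (1 + σ / 2 + (torusDist x y : ℝ) ^ 2) ^ 3) ≤
      24576 / ((1 + σ / 2) * (1 + σ + (torusDist x z : ℝ) ^ 2) ^ 3) := by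
  have hs : (1 : ℝ) ≤ 1 + σ / 2 := by linarith
  have hs0 : (0 : ℝ) < 1 + σ / 2 := by linarith
  have hB : 0 < 1 + σ + (torusDist x z : ℝ) ^ 2 := by positivity
  have h1 := sum_inv_cube_le z hs
  have h2 := sum_inv_cube_le x hs
  calc ∑ y : TorusSite 4 L, 1 / (1 + σ / 2 + (torusDist z y : ℝ) ^ 2) ^ 3 *
        (1 / (1 + σ / 2 + (torusDist x y : ℝ) ^ 2) ^ 3)
      ≤ ∑ y : TorusSite 4 L, 64 / (1 + σ + (torusDist x z : ℝ) ^ 2) ^ 3 *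
          (1 / (1 + σ / 2 + (torusDist z y : ℝ) ^ 2) ^ 3 +
            1 / (1 + σ / 2 + (torusDist x y : ℝ) ^ 2) ^ 3) := by
        refine Finset.sum_le_sum fun y _ => conv_pointwise hσ ?_
        calc torusDist x z ≤ torusDist x y + torusDist y z := torusDist_triangle' _ _ _
          _ = torusDist x y + torusDist z y := by rw [torusDist_comm' y z]
    _ = 64 / (1 + σ + (torusDist x z : ℝ) ^ 2) ^ 3 *
          (∑ y : TorusSite 4 L, 1 / (1 + σ / 2 + (torusDist z y : ℝ) ^ 2) ^ 3 +
            ∑ y : TorusSite 4 L, 1 / (1 + σ / 2 + (torusDist x y : ℝ) ^ 2) ^ 3) := by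
        rw [← Finset.sum_add_distrib, Finset.mul_sum]
    _ ≤ 64 / (1 + σ + (torusDist x z : ℝ) ^ 2) ^ 3 * (192 / (1 + σ / 2) + 192 / (1 + σ / 2)) := by
        gcongr
    _ = 24576 / ((1 + σ / 2) * (1 + σ + (torusDist x z : ℝ) ^ 2) ^ 3) := by
        field_simp
        ring

/-! ### The stub -/

/-- **FreeTimeDerivativeProfile** (registered stub `stub_freeTimeDerivativeProfile` of line `Sketch`):
the time derivative `H₁ e^{-σH₁}` of the free Wilson heat kernel (`H₁ = D₁ᴴD₁`, all links `= 1`,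
Wilson parameter `1`, mass `m ∈ [-1/2,1]`, `0 ≤ σ ≤ L²`) has the free profile with one more inverse
power of `1 + σ`: `|(H₁e^{-σH₁})((z,b,β),(x,a,α))| ≤ C e^{-cσm²}/(1+σ+d(x,z)²)³`.  T*T factorisation
`H₁e^{-σH₁} = (D₁e^{-(σ/2)H₁})ᴴ(D₁e^{-(σ/2)H₁})`, the landed `D₁`-profile `stub_freeColumnProfile` (2)
for both factors, and the lattice convolution `freeTimeDerivativeProfile_convolution`. -/
theorem stub_freeTimeDerivativeProfile :
    ∃ C c : ℝ, 0 < c ∧ ∀ (L : ℕ) [NeZero L] (m : ℝ), m ∈ Set.Icc (-(1 / 2 : ℝ)) 1 →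
    ∀ σ : ℝ, 0 ≤ σ → σ ≤ (L : ℝ) ^ 2 → ∀ (x z : TorusSite 4 L) (a b : Fin 3) (α β : Fin 4),
      ‖(((wilsonDirac (fundamentalRep (Fin 3))
              (fun _ : Edge 4 L => (1 : Matrix.specialUnitaryGroup (Fin 3) ℂ)) m 1)ᴴ *
            wilsonDirac (fundamentalRep (Fin 3))
              (fun _ : Edge 4 L => (1 : Matrix.specialUnitaryGroup (Fin 3) ℂ)) m 1) *
          NormedSpace.exp (-(σ : ℂ) •
            ((wilsonDirac (fundamentalRep (Fin 3))
                (fun _ : Edge 4 L => (1 : Matrix.specialUnitaryGroup (Fin 3) ℂ)) m 1)ᴴ *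
              wilsonDirac (fundamentalRep (Fin 3))
                (fun _ : Edge 4 L => (1 : Matrix.specialUnitaryGroup (Fin 3) ℂ)) m 1))) (z, b, β) (x, a, α)‖ ≤
        C * Real.exp (-(c * σ * m ^ 2)) / (1 + σ + (torusDist x z : ℝ) ^ 2) ^ 3 := by
  obtain ⟨C, c, hc, h⟩ := stub_freeColumnProfile
  refine ⟨294912 * C ^ 2, c, hc, ?_⟩
  intro L _ m hm σ hσ hσL x z a b α β
  set D : Matrix (TorusSite 4 L × Fin 3 × Fin 4) (TorusSite 4 L × Fin 3 × Fin 4) ℂ :=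
    wilsonDirac (fundamentalRep (Fin 3))
      (fun _ : Edge 4 L => (1 : Matrix.specialUnitaryGroup (Fin 3) ℂ)) m 1 with hD
  set K : Matrix (TorusSite 4 L × Fin 3 × Fin 4) (TorusSite 4 L × Fin 3 × Fin 4) ℂ :=
    NormedSpace.exp (-((σ / 2 : ℝ) : ℂ) • (Dᴴ * D)) with hK
  have hσ2 : 0 ≤ σ / 2 := by linarith
  have hσ2L : σ / 2 ≤ (L : ℝ) ^ 2 := by linarith
  -- the landed `D₁`-profile at time `σ/2`, for both factors
  have hprof : ∀ (y : TorusSite 4 L) (c' : Fin 3) (γ : Fin 4) (w : TorusSite 4 L) (e : Fin 3)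
      (η : Fin 4), ‖(D * K) (y, c', γ) (w, e, η)‖ ≤
      C * Real.exp (-(c * (σ / 2) * m ^ 2)) * Real.sqrt (1 + σ / 2) /
        (1 + σ / 2 + (torusDist w y : ℝ) ^ 2) ^ 3 :=
    fun y c' γ w e η => (h L m hm (σ / 2) hσ2 hσ2L w y e c' η γ).2
  -- abbreviations
  set E' : ℝ := Real.exp (-(c * (σ / 2) * m ^ 2)) with hE'
  set S : ℝ := Real.sqrt (1 + σ / 2) with hS
  set P : ℝ := 1 + σ + ((torusDist x z : ℕ) : ℝ) ^ 2 with hP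
  have hs0 : (0 : ℝ) < 1 + σ / 2 := by linarith
  have hP0 : 0 < P := by positivity
  have hS2 : S ^ 2 = 1 + σ / 2 := Real.sq_sqrt hs0.le
  have hEsq : E' ^ 2 = Real.exp (-(c * σ * m ^ 2)) := by
    rw [hE', sq, ← Real.exp_add]
    congr 1
    ring
  -- step 1: T*T form and the entry bound
  rw [conjTranspose_mul_self_mul_exp_eq D σ]
  refine (norm_conjTranspose_mul_self_apply_le (D * K) (z, b, β) (x, a, α)).trans ?_
  rw [sum_siteColourSpin]
  -- step 2: plug the profiles
  calc ∑ y : TorusSite 4 L, ∑ c' : Fin 3, ∑ γ : Fin 4,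
        ‖(D * K) (y, c', γ) (z, b, β)‖ * ‖(D * K) (y, c', γ) (x, a, α)‖
      ≤ ∑ y : TorusSite 4 L, ∑ _c' : Fin 3, ∑ _γ : Fin 4,
          (C * E' * S) ^ 2 * (1 / (1 + σ / 2 + (torusDist z y : ℝ) ^ 2) ^ 3 *
            (1 / (1 + σ / 2 + (torusDist x y : ℝ) ^ 2) ^ 3)) := by
        refine Finset.sum_le_sum fun y _ => Finset.sum_le_sum fun c' _ =>
          Finset.sum_le_sum fun γ _ => ?_
        have h1 := hprof y c' γ z b β
        have h2 := hprof y c' γ x a α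
        calc ‖(D * K) (y, c', γ) (z, b, β)‖ * ‖(D * K) (y, c', γ) (x, a, α)‖
            ≤ (C * E' * S / (1 + σ / 2 + (torusDist z y : ℝ) ^ 2) ^ 3) *
                (C * E' * S / (1 + σ / 2 + (torusDist x y : ℝ) ^ 2) ^ 3) :=
              mul_le_mul h1 h2 (norm_nonneg _) ((norm_nonneg _).trans h1)
          _ = (C * E' * S) ^ 2 * (1 / (1 + σ / 2 + (torusDist z y : ℝ) ^ 2) ^ 3 *
                (1 / (1 + σ / 2 + (torusDist x y : ℝ) ^ 2) ^ 3)) := by ring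
    _ = 12 * (C * E' * S) ^ 2 * ∑ y : TorusSite 4 L,
          1 / (1 + σ / 2 + (torusDist z y : ℝ) ^ 2) ^ 3 *
            (1 / (1 + σ / 2 + (torusDist x y : ℝ) ^ 2) ^ 3) := by
        rw [Finset.mul_sum]
        refine Finset.sum_congr rfl fun y _ => ?_
        simp only [Finset.sum_const, Finset.card_univ, Fintype.card_fin, nsmul_eq_mul]
        push_cast
        ring
    -- step 3: the convolution
    _ ≤ 12 * (C * E' * S) ^ 2 * (24576 / ((1 + σ / 2) * P ^ 3)) := by
        gcongr
        exact freeTimeDerivativeProfile_convolution x z hσ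
    -- step 4: bookkeeping
    _ = 294912 * C ^ 2 * Real.exp (-(c * σ * m ^ 2)) / P ^ 3 := by
        rw [← hEsq, mul_pow, mul_pow, hS2]
        field_simp
        ring

end Summit.QuantumFields.QCD.Cruxes.TracedQuadraticParametrix.Sketch

end
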